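import Mathlib
import Summits.Ventures.LatticeQCDFlow.Scoring.CalibrationTruths
import Summits.Ventures.LatticeQCDFlow.Scoring.FejerPairSums
import Summits.Ventures.LatticeQCDFlow.Scoring.BartlettKernel
import Summits.Ventures.LatticeQCDFlow.Scoring.MadrasSokalErrorFormula
import Summits.Ventures.LatticeQCDFlow.Scoring.MadrasSokalRatioVariance
import HarnessLib

/-!
# The Madras–Sokal error bar on calibration set C-1 (`ρ(t) = r^t`): `K(u) = r^u (u + (1+r²)/(1−r²))`, `K(0) = τ + 1/(4τ)`, and the ratio correction `L = −6τ³ + 4τ² − 1/(8τ)`; eventually `R(W) < (4W − 6τ + 4) τ²`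

HONEST FRAMING: exact (Metropolis-corrected) sampling algorithms for lattice gauge theory;
figures of merit are autocorrelation/cost numbers at stated couplings and volumes; no
continuum-physics claim.

Venture `LatticeQCDFlow` (cell pub-lqcd), sub-topic `Scoring`; FANOUT row 16 (`su2-base`), GEN-6.
NEW WORK of the cell over this packet (`BartlettKernel`, `MadrasSokalErrorFormula`,
`MadrasSokalRatioVariance`) and `CalibrationTruths` (set C-1: `ρ t = r^t`, `τ_int = (1+r)/(2(1−r))`,
`tauInt_geometric`).  Nothing is cited as a fact.  Printed counterparts, NAMED ONLY: Madras–Sokal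
1988 App. C; Wolff 2004 eq. (42) (`⟨δτ²⟩ ≈ (4/N)(W + ½ − τ)τ²`, i.e. a correction `−4τ³`).

Sixth file of the ERROR-OF-THE-ERROR packet: the closed forms on the cell's calibration family
C-1 (`FITNESS.md` §A; scorer A/B acceptance is judged on C-1 chains), `0 ≤ r < 1`,
`τ = tauInt (r^·) = (1+r)/(2(1−r)) ≥ ½`:

* **`acfConv_geometric`** — `K(u) = Σ_{m∈ℤ} r^{|m|} r^{|m+u|} = r^u (u + (1+r²)/(1−r²))` for `u ≥ 0`
  (split `ℤ` at `0`; the `u − 1` 'inner' lags each contribute `r^u`, the two geometric tails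
  `r^u/(1−r²)` and `r^{u+2}/(1−r²)`);
* `acfConv_zero_geometric`, **`acfConv_zero_geometric_eq`** — `K(0) = (1+r²)/(1−r²) = τ + 1/(4τ)`;
* **`ratioLimit_geometric`** — the `W → ∞` limit of the ratio correction
  `R(W) − V(W) → L` (`MadrasSokalRatioVariance.tendsto_tauHatRatioAVar_sub`) is, on C-1, EXACTLY
  `L = −6τ³ + 4τ² − 1/(8τ)` (from `L = −4τ₁S₁ + 2K(0)τ₁²`, `S₁ = 2τ² − K(0)/2`, `τ₁ = τ − ½`);
* **`eventually_tauHatRatioAVar_lt_geometric`** — hence, with `V(W) ≤ 4Wτ²`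
  (`tauHatAVar_le`, `ρ ≥ 0`): for all large `W`, `R(W) < (4W − 6τ + 4)·τ²`, i.e. the Gaussian-model
  `N · Var` of the linearised ratio estimator sits at least `(6τ − 2)τ²` BELOW the printed
  `N δτ_B² = (4W+2)τ²`.  Read at a self-consistent window `W = cτ` this deficit is the fraction
  `(6τ − 2)/(4cτ + 2) → 3/(2c)` of the printed variance (`25 %` at scorer B's `c = 6`) — a REMARK,
  since the theorem is asymptotic in `W` at fixed `τ`; the cell's direct evaluation of `R(W)` at
  `W = 6τ` gives `R/((4W+2)τ²) ≈ 0.63` for `τ ∈ [4.5, 19.5]` (HOME/su2-base/lean-gen6/ms_check2.py;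
  Monte Carlo `ms_mc2.py` on AR(1), `N = 2·10⁴`, 800 replicas: `N Var/τ² = 73.7 ± 3.7` vs predicted
  `70.1`), so the printed bar there is ≈ `1.26 ×` the model standard deviation: CONSERVATIVE.
  Wolff's `−4τ³` (eq. (42)) has the right sign and about half the C-1 magnitude of the `V` + ratio
  corrections.

NOT CLAIMED: the constant of `V(W) − 4Wτ²` itself on C-1 (it is `−Σ_{u≥1}(u+1)K(u) = −3τ³ + O(τ²)`,
not typed: needs the first-moment refinement of the Fejér limit for the kernel); anything at the
finite window `W = cτ` as a theorem; the delta-method remainder; non-Gaussian data.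
-/

noncomputable section

open Finset Filter Topology

namespace Summit.Ventures.LatticeQCDFlow.Scoring

/-! ## `K(u)` in closed form on C-1 -/

/-- `ρ̄(m) = ρ(n)` when `m = n`. -/
theorem evenExt_eq_of_eq_natCast (ρ : ℕ → ℝ) {m : ℤ} {n : ℕ} (h : m = n) : evenExt ρ m = ρ n := by
  subst h
  exact evenExt_natCast ρ n

/-- `ρ̄(m) = ρ(n)` when `m = −n`. -/
theorem evenExt_eq_of_eq_neg_natCast (ρ : ℕ → ℝ) {m : ℤ} {n : ℕ} (h : m = -(n : ℤ)) :
    evenExt ρ m = ρ n := by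
  subst h
  rw [evenExt_neg, evenExt_natCast]

section Geometric

variable {r : ℝ}

/-- Set C-1 is summable: `Σ r^t < ∞` for `0 ≤ r < 1`. -/
theorem summable_geometric_C1 (h0 : 0 ≤ r) (h1 : r < 1) : Summable fun t : ℕ => r ^ t :=
  summable_geometric_of_lt_one h0 h1

/-- `|r| < 1` on C-1. -/
theorem abs_lt_one_C1 (h0 : 0 ≤ r) (h1 : r < 1) : |r| < 1 := abs_lt.mpr ⟨by linarith, h1⟩

/-- **`K(u) = r^u (u + (1+r²)/(1−r²))`** for `u ≥ 0` on C-1 (`0 ≤ r < 1`). -/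
theorem acfConv_geometric (h0 : 0 ≤ r) (h1 : r < 1) (u : ℕ) :
    acfConv (evenExt fun t => r ^ t) (u : ℤ) = r ^ u * (u + (1 + r ^ 2) / (1 - r ^ 2)) := by
  set ρ : ℕ → ℝ := fun t => r ^ t with hρ_def
  have hρs : Summable ρ := summable_geometric_C1 h0 h1
  have hr2 : r ^ 2 < 1 := by nlinarith
  have hr2' : 0 ≤ r ^ 2 := sq_nonneg r
  have h1r2 : (1 : ℝ) - r ^ 2 ≠ 0 := by linarith
  have hgeo : ∑' k : ℕ, (r ^ 2) ^ k = (1 - r ^ 2)⁻¹ := tsum_geometric_of_lt_one hr2' hr2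
  -- the summand over `ℤ` and its three pieces
  set g : ℤ → ℝ := fun m => evenExt ρ m * evenExt ρ (m + u) with hg_def
  have hg : Summable g := summable_mul_shift (summable_evenExt hρs) u
  have hg0 : g 0 = r ^ u := by
    simp only [hg_def, zero_add, evenExt_zero, evenExt_natCast, hρ_def, pow_zero, one_mul]
  have hgpos : ∀ t : ℕ, g ((t : ℤ) + 1) = r ^ (u + 2) * (r ^ 2) ^ t := by
    intro t
    simp only [hg_def]
    rw [evenExt_eq_of_eq_natCast ρ (n := t + 1) (by push_cast; ring),
      evenExt_eq_of_eq_natCast ρ (n := t + 1 + u) (by push_cast; ring)]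
    simp only [hρ_def]
    rw [← pow_mul, ← pow_add, ← pow_add]
    congr 1
    ring
  have hgneg_lt : ∀ t : ℕ, t < u → g (-((t : ℤ) + 1)) = r ^ u := by
    intro t ht
    simp only [hg_def]
    rw [evenExt_eq_of_eq_neg_natCast ρ (n := t + 1) (by push_cast; ring),
      evenExt_eq_of_eq_natCast ρ (n := u - (t + 1)) (by push_cast [Nat.cast_sub (by omega : t + 1 ≤ u)]; ring)]
    simp only [hρ_def]
    rw [← pow_add]
    congr 1
    omega
  have hgneg_ge : ∀ k : ℕ, g (-(((k + u : ℕ) : ℤ) + 1)) = r ^ (u + 2) * (r ^ 2) ^ k := by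
    intro k
    simp only [hg_def]
    rw [evenExt_eq_of_eq_neg_natCast ρ (n := k + u + 1) (by push_cast; ring),
      evenExt_eq_of_eq_neg_natCast ρ (n := k + 1) (by push_cast; ring)]
    simp only [hρ_def]
    rw [← pow_mul, ← pow_add, ← pow_add]
    congr 1
    ring
  -- assemble
  have hsum_pos : ∑' t : ℕ, g ((t : ℤ) + 1) = r ^ (u + 2) * (1 - r ^ 2)⁻¹ := by
    simp_rw [hgpos]
    rw [tsum_mul_left, hgeo]
  have hsneg : Summable fun t : ℕ => g (-((t : ℤ) + 1)) := summable_negSucc_of_summable_int hg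
  have hsum_neg : ∑' t : ℕ, g (-((t : ℤ) + 1)) = u * r ^ u + r ^ (u + 2) * (1 - r ^ 2)⁻¹ := by
    rw [← hsneg.sum_add_tsum_nat_add u]
    have hA : ∑ t ∈ range u, g (-((t : ℤ) + 1)) = u * r ^ u := by
      rw [sum_congr rfl fun t ht => hgneg_lt t (mem_range.mp ht), sum_const, card_range, nsmul_eq_mul]
    have hB : ∑' k : ℕ, g (-(((k + u : ℕ) : ℤ) + 1)) = r ^ (u + 2) * (1 - r ^ 2)⁻¹ := by
      simp_rw [hgneg_ge]
      rw [tsum_mul_left, hgeo]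
    rw [hA, hB]
  rw [acfConv_def, show (fun m => evenExt ρ m * evenExt ρ (m + u)) = g from rfl,
    tsum_int_eq_zero_add_tsum_nat hg, (summable_nat_succ_of_summable_int hg).tsum_add hsneg,
    hg0, hsum_pos, hsum_neg]
  field_simp
  ring

/-- `K(0) = (1+r²)/(1−r²)` on C-1. -/
theorem acfConv_zero_geometric (h0 : 0 ≤ r) (h1 : r < 1) :
    acfConv (evenExt fun t => r ^ t) 0 = (1 + r ^ 2) / (1 - r ^ 2) := by
  have := acfConv_geometric h0 h1 0
  simp only [Nat.cast_zero, pow_zero, one_mul, zero_add] at this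
  exact this

/-- `τ_int > 0` on C-1 (indeed `≥ ½`). -/
theorem tauInt_geometric_pos (h0 : 0 ≤ r) (h1 : r < 1) : 0 < tauInt (fun t => r ^ t) := by
  rw [tauInt_geometric (abs_lt_one_C1 h0 h1)]
  exact div_pos (by linarith) (by linarith)

/-- **`K(0) = τ + 1/(4τ)`** on C-1, `τ = τ_int = (1+r)/(2(1−r))`. -/
theorem acfConv_zero_geometric_eq (h0 : 0 ≤ r) (h1 : r < 1) :
    acfConv (evenExt fun t => r ^ t) 0
      = tauInt (fun t => r ^ t) + 1 / (4 * tauInt (fun t => r ^ t)) := by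
  rw [acfConv_zero_geometric h0 h1, tauInt_geometric (abs_lt_one_C1 h0 h1)]
  have h1r : (1 : ℝ) - r ≠ 0 := by linarith
  have h1r' : (1 : ℝ) + r ≠ 0 := by linarith
  have h1r2 : (1 : ℝ) - r ^ 2 ≠ 0 := by
    have : r ^ 2 < 1 := by nlinarith
    linarith
  field_simp
  ring

/-! ## The ratio correction on C-1: `L = −6τ³ + 4τ² − 1/(8τ)` -/

/-- **`L = −6τ³ + 4τ² − 1/(8τ)`** on C-1: the `W → ∞` limit of `R(W) − V(W)`
(`MadrasSokalRatioVariance.ratioLimit`). -/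
theorem ratioLimit_geometric (h0 : 0 ≤ r) (h1 : r < 1) :
    ratioLimit (fun t => r ^ t)
      = -6 * tauInt (fun t => r ^ t) ^ 3 + 4 * tauInt (fun t => r ^ t) ^ 2
        - 1 / (8 * tauInt (fun t => r ^ t)) := by
  have hρs : Summable fun t : ℕ => r ^ t := summable_geometric_C1 h0 h1
  have hτ := tauInt_geometric_pos h0 h1
  rw [ratioLimit, tsum_acfConv_succ_eq hρs (pow_zero r), acfConv_zero_geometric_eq h0 h1]
  field_simp
  ring

/-- `L < −6τ³ + 4τ²` on C-1. -/
theorem ratioLimit_geometric_lt (h0 : 0 ≤ r) (h1 : r < 1) :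
    ratioLimit (fun t => r ^ t)
      < -6 * tauInt (fun t => r ^ t) ^ 3 + 4 * tauInt (fun t => r ^ t) ^ 2 := by
  rw [ratioLimit_geometric h0 h1]
  have hτ := tauInt_geometric_pos h0 h1
  have : 0 < 1 / (8 * tauInt (fun t => r ^ t)) := by positivity
  linarith

/-- **Eventually `R(W) < (4W − 6τ + 4) τ²` on C-1**: for all large windows the Gaussian-model
`N · Var` of the linearised ratio estimator is at least `(6τ − 2)τ²` below the printed
`N δτ_B² = (4W + 2) τ²`. -/
theorem eventually_tauHatRatioAVar_lt_geometric (h0 : 0 ≤ r) (h1 : r < 1) :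
    ∀ᶠ W : ℕ in atTop, tauHatRatioAVar (fun t => r ^ t) W
      < (4 * W - 6 * tauInt (fun t => r ^ t) + 4) * tauInt (fun t => r ^ t) ^ 2 := by
  have hρs : Summable fun t : ℕ => r ^ t := summable_geometric_C1 h0 h1
  have hnn : ∀ t, 0 ≤ (fun t : ℕ => r ^ t) t := fun t => pow_nonneg h0 t
  have hev := (tendsto_tauHatRatioAVar_sub hρs).eventually
    (gt_mem_nhds (ratioLimit_geometric_lt h0 h1))
  filter_upwards [hev] with W hW
  have hV := tauHatAVar_le hρs (pow_zero r) hnn W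
  nlinarith

/-- The same in 'printed' units: eventually
`R(W) < (4W + 2) τ² − (6τ − 2) τ²`, a deficit of at least `(6τ − 2) τ² ≥ τ²` (`τ ≥ ½`). -/
theorem eventually_tauHatRatioAVar_lt_printed_sub_geometric (h0 : 0 ≤ r) (h1 : r < 1) :
    ∀ᶠ W : ℕ in atTop, tauHatRatioAVar (fun t => r ^ t) W
      < (4 * W + 2) * tauInt (fun t => r ^ t) ^ 2
        - (6 * tauInt (fun t => r ^ t) - 2) * tauInt (fun t => r ^ t) ^ 2 := by
  filter_upwards [eventually_tauHatRatioAVar_lt_geometric h0 h1] with W hW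
  linarith

/-- On C-1 `τ_int ≥ ½`, so the eventual deficit `(6τ − 2)τ²` is at least `τ²`. -/
theorem half_le_tauInt_geometric (h0 : 0 ≤ r) (h1 : r < 1) : 1 / 2 ≤ tauInt (fun t => r ^ t) := by
  rw [tauInt_geometric (abs_lt_one_C1 h0 h1), div_le_div_iff₀ (by norm_num) (by linarith)]
  linarith

end Geometric

end Summit.Ventures.LatticeQCDFlow.Scoring
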